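import Summits.ResolutionOfSingularities.ResolutionOfSingularities.Theorems.FrobeniusLadderFInjectiveMacaulayficationFullLastCentreKitTools
import HarnessLib

/-!
# THE TYPED DOOR `DoorCoordProxy` (cone-initial cut (LC)) IS FALSE AT BED cʼs CANONICAL SURFACE CENTRE Π₂ — KERNEL NEGATIVE (instance, every hypothesis certified)
# (crux `FInjectiveMacaulayfication` stmt-ResolutionOfSingularities-15315, chain w45a; res-L1-w45a-plan-1 RULING R25.41 (B)/(iii) «`not_doorCoordProxy` over ZMod 11 from the dump (a kernel
# NEGATIVE for the record … --supports helper)», res-L1-w45a-lead-1 g16 «TAKE IT» + conventions (STATUS l.39274); data = res-L1-w45a-tri-2 g23 dump `g23/cc/door_instance_bedc.json`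
# sha16 b752767d37e69ff0 (stage 2 of bed c = bed a + y₄⁴ + y₃⁵ over 𝔽₁₁, chart `Bl_{x₀}@y₁ > Bl_{C₁}@e₁`), re-verified by res-L1-w45a-stub-1 g17 `g17-door/verify.py`; definitions =
# res-L1-w45a-lead-1 g16 ✓p727906 `FullLastCentreDefs`; generic tools = `…FullLastCentreKitTools`; seat res-L1-w45a-stub-1 g17)

[OURS · L1 W4.5a] Support file (`--supports stmt-ResolutionOfSingularities-15315 --as helper`); DATA definitions (term lists) + theorems; no named fact; NOT a statement of any manuscript; nothing
of the crux is proved — on the contrary, an INTERMEDIATE typed door of the T-side is REFUTED by an explicit instance (the cap MC-8ᶜ itself is NOT refuted: the exact one-step law gives ρ′ = 6 ≤ 8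
at the same instance, evidence level). AI-written (AI review is weaker than expert review).

THE INSTANCE (letters `(t′, ỹ₂, ỹ₃, y₄″) = Letter 0, 1, 2, 3`; field: ANY `K` of characteristic 11). Stage `S`: the monic cubic `x″³ + b₂x″² + b₁x″ + b₀` of bed c at the chart origin `x₂`
(`b₂, b₁, b₀` with 6 / 11 / 24 monomials, §1), exceptional letters `Exc = {t′}` with signed defect `d_{t′} = 1`; centre `Z = Π₂ = V(x″, t′, y₄″)`, i.e. `Nor = {0, 3}`, direction `L = t′ = 0`;
`S′` = the `t′`-chart origin of `Bl_{Π₂}` (`b₂′, b₁′, b₀′`, `Exc′ = {t′}`, `d′ ≡ 0`); residual decomposition `Disc_x(S) = t′⁴·N₂` with `N₂` the 235-term polynomial of §1 (`α = 4·ε₀`).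
CERTIFIED (§3): `Nor.Nonempty`, `Nor ≠ univ`, `L ∈ Nor`, `Permissible S Nor`, `CoordCanonical S Nor`, `Budgeted S` (witness `x″·t′·y₄″`), `IsChart S Nor L S′`, `IsDropPoint S′`, `Budgeted S′`
(witness `x‴·y₄‴`), `IsResidual S.Exc S.D (4ε₀) N₂` (the discriminant identity through the ✓ `KLocCellKit` keyed arithmetic, one `decide +kernel`), and ★★ `¬ AxisOrdLE Nor L N₂ 8` (the minimal
normal degree is `ν = 2`, attained exactly by `t′²ỹ₂^k`, `k = 11…18`, of total degree `13…20 > 8 + 2`). Hence ★★★ `counterexample` (the conjunction, over every field of characteristic 11) and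
★★★ `not_lastCentreConeBound_coordCanonical`: the ∀-statement `LastCentreConeBound CoordCanonical` of `Lines/T_canon_door.lean` §3 (restated verbatim) is FALSE.
[folklore computation]
-/

-- single-problem summit: the doubled namespace component is forced
set_option linter.dupNamespace false

noncomputable section

open MvPolynomial Finsupp

namespace Summit.ResolutionOfSingularities.ResolutionOfSingularities.Theorems.FInjectiveMacaulayfication.LastCentreBedC

open Summit.ResolutionOfSingularities.ResolutionOfSingularities.Theorems.FInjectiveMacaulayfication LastCentreDefs KLocCellKit LastCentreKit

/-! ## §1 The data (term lists `(coefficient, exponent vector)`; coefficients are the dumpʼs residues mod 11) -/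

/-- `b₂` of stage 2 (coefficient of `x″²`; 6 monomials). [data; tri-2 dump b752767d37e69ff0] -/
def b2L : List (ℤ × (Fin 4 → ℕ)) :=
  [((10 : ℤ), (![0, 0, 0, 1] : Fin 4 → ℕ)), ((1 : ℤ), (![1, 0, 0, 0] : Fin 4 → ℕ)), ((6 : ℤ), (![1, 1, 0, 0] : Fin 4 → ℕ)), ((3 : ℤ), (![1, 2, 0, 0] : Fin 4 → ℕ)), ((5 : ℤ), (![1, 3, 0, 0] : Fin 4 → ℕ)), ((6 : ℤ), (![4, 0, 2, 1] : Fin 4 → ℕ))]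

/-- `b₁` of stage 2 (11 monomials). [data] -/
def b1L : List (ℤ × (Fin 4 → ℕ)) :=
  [((4 : ℤ), (![0, 0, 0, 2] : Fin 4 → ℕ)), ((3 : ℤ), (![1, 0, 0, 1] : Fin 4 → ℕ)), ((7 : ℤ), (![1, 1, 0, 1] : Fin 4 → ℕ)), ((9 : ℤ), (![1, 2, 0, 1] : Fin 4 → ℕ)), ((4 : ℤ), (![1, 3, 0, 1] : Fin 4 → ℕ)), ((1 : ℤ), (![2, 1, 0, 0] : Fin 4 → ℕ)), ((3 : ℤ), (![2, 2, 0, 0] : Fin 4 → ℕ)), ((9 : ℤ), (![2, 3, 0, 0] : Fin 4 → ℕ)), ((10 : ℤ), (![2, 4, 0, 0] : Fin 4 → ℕ)), ((6 : ℤ), (![2, 5, 0, 0] : Fin 4 → ℕ)), ((9 : ℤ), (![2, 6, 0, 0] : Fin 4 → ℕ))]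

/-- `b₀` of stage 2 (24 monomials). [data] -/
def b0L : List (ℤ × (Fin 4 → ℕ)) :=
  [((2 : ℤ), (![0, 0, 0, 3] : Fin 4 → ℕ)), ((5 : ℤ), (![1, 0, 0, 2] : Fin 4 → ℕ)), ((8 : ℤ), (![1, 1, 0, 2] : Fin 4 → ℕ)), ((4 : ℤ), (![1, 2, 0, 2] : Fin 4 → ℕ)), ((3 : ℤ), (![1, 3, 0, 2] : Fin 4 → ℕ)), ((1 : ℤ), (![2, 0, 0, 4] : Fin 4 → ℕ)), ((7 : ℤ), (![2, 1, 0, 1] : Fin 4 → ℕ)), ((10 : ℤ), (![2, 2, 0, 1] : Fin 4 → ℕ)), ((8 : ℤ), (![2, 3, 0, 1] : Fin 4 → ℕ)), ((4 : ℤ), (![2, 4, 0, 1] : Fin 4 → ℕ)), ((9 : ℤ), (![2, 5, 0, 1] : Fin 4 → ℕ)), ((8 : ℤ), (![2, 6, 0, 1] : Fin 4 → ℕ)),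
   ((8 : ℤ), (![3, 1, 2, 2] : Fin 4 → ℕ)), ((3 : ℤ), (![3, 2, 0, 0] : Fin 4 → ℕ)), ((7 : ℤ), (![3, 3, 0, 0] : Fin 4 → ℕ)), ((10 : ℤ), (![3, 4, 0, 0] : Fin 4 → ℕ)), ((6 : ℤ), (![3, 5, 0, 0] : Fin 4 → ℕ)), ((10 : ℤ), (![3, 6, 0, 0] : Fin 4 → ℕ)), ((4 : ℤ), (![3, 7, 0, 0] : Fin 4 → ℕ)), ((4 : ℤ), (![3, 8, 0, 0] : Fin 4 → ℕ)), ((3 : ℤ), (![3, 9, 0, 0] : Fin 4 → ℕ)), ((1 : ℤ), (![4, 0, 5, 0] : Fin 4 → ℕ)), ((10 : ℤ), (![5, 1, 4, 1] : Fin 4 → ℕ)), ((1 : ℤ), (![6, 0, 2, 4] : Fin 4 → ℕ))]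

/-- `b₂′` of the `t′`-chart origin of `Bl_Π₂` (6 monomials). [data] -/
def b2L' : List (ℤ × (Fin 4 → ℕ)) :=
  [((1 : ℤ), (![0, 0, 0, 0] : Fin 4 → ℕ)), ((10 : ℤ), (![0, 0, 0, 1] : Fin 4 → ℕ)), ((6 : ℤ), (![0, 1, 0, 0] : Fin 4 → ℕ)), ((3 : ℤ), (![0, 2, 0, 0] : Fin 4 → ℕ)), ((5 : ℤ), (![0, 3, 0, 0] : Fin 4 → ℕ)), ((6 : ℤ), (![4, 0, 2, 1] : Fin 4 → ℕ))]

/-- `b₁′` (11 monomials). [data] -/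
def b1L' : List (ℤ × (Fin 4 → ℕ)) :=
  [((3 : ℤ), (![0, 0, 0, 1] : Fin 4 → ℕ)), ((4 : ℤ), (![0, 0, 0, 2] : Fin 4 → ℕ)), ((1 : ℤ), (![0, 1, 0, 0] : Fin 4 → ℕ)), ((7 : ℤ), (![0, 1, 0, 1] : Fin 4 → ℕ)), ((3 : ℤ), (![0, 2, 0, 0] : Fin 4 → ℕ)), ((9 : ℤ), (![0, 2, 0, 1] : Fin 4 → ℕ)), ((9 : ℤ), (![0, 3, 0, 0] : Fin 4 → ℕ)), ((4 : ℤ), (![0, 3, 0, 1] : Fin 4 → ℕ)), ((10 : ℤ), (![0, 4, 0, 0] : Fin 4 → ℕ)), ((6 : ℤ), (![0, 5, 0, 0] : Fin 4 → ℕ)), ((9 : ℤ), (![0, 6, 0, 0] : Fin 4 → ℕ))]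

/-- `b₀′` (24 monomials). [data] -/
def b0L' : List (ℤ × (Fin 4 → ℕ)) :=
  [((5 : ℤ), (![0, 0, 0, 2] : Fin 4 → ℕ)), ((2 : ℤ), (![0, 0, 0, 3] : Fin 4 → ℕ)), ((7 : ℤ), (![0, 1, 0, 1] : Fin 4 → ℕ)), ((8 : ℤ), (![0, 1, 0, 2] : Fin 4 → ℕ)), ((3 : ℤ), (![0, 2, 0, 0] : Fin 4 → ℕ)), ((10 : ℤ), (![0, 2, 0, 1] : Fin 4 → ℕ)), ((4 : ℤ), (![0, 2, 0, 2] : Fin 4 → ℕ)), ((7 : ℤ), (![0, 3, 0, 0] : Fin 4 → ℕ)), ((8 : ℤ), (![0, 3, 0, 1] : Fin 4 → ℕ)), ((3 : ℤ), (![0, 3, 0, 2] : Fin 4 → ℕ)), ((10 : ℤ), (![0, 4, 0, 0] : Fin 4 → ℕ)), ((4 : ℤ), (![0, 4, 0, 1] : Fin 4 → ℕ)),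
   ((6 : ℤ), (![0, 5, 0, 0] : Fin 4 → ℕ)), ((9 : ℤ), (![0, 5, 0, 1] : Fin 4 → ℕ)), ((10 : ℤ), (![0, 6, 0, 0] : Fin 4 → ℕ)), ((8 : ℤ), (![0, 6, 0, 1] : Fin 4 → ℕ)), ((4 : ℤ), (![0, 7, 0, 0] : Fin 4 → ℕ)), ((4 : ℤ), (![0, 8, 0, 0] : Fin 4 → ℕ)), ((3 : ℤ), (![0, 9, 0, 0] : Fin 4 → ℕ)), ((1 : ℤ), (![1, 0, 5, 0] : Fin 4 → ℕ)), ((8 : ℤ), (![2, 1, 2, 2] : Fin 4 → ℕ)), ((1 : ℤ), (![3, 0, 0, 4] : Fin 4 → ℕ)), ((10 : ℤ), (![3, 1, 4, 1] : Fin 4 → ℕ)), ((1 : ℤ), (![7, 0, 2, 4] : Fin 4 → ℕ))]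

/-- The residual `N₂ = Disc_x(S)/t′⁴` (235 monomials). [data] -/
def N2L : List (ℤ × (Fin 4 → ℕ)) :=
  [((6 : ℤ), (![0, 0, 0, 8] : Fin 4 → ℕ)), ((7 : ℤ), (![1, 0, 0, 4] : Fin 4 → ℕ)), ((1 : ℤ), (![1, 1, 0, 4] : Fin 4 → ℕ)), ((8 : ℤ), (![1, 1, 2, 6] : Fin 4 → ℕ)), ((5 : ℤ), (![1, 2, 0, 4] : Fin 4 → ℕ)), ((5 : ℤ), (![1, 3, 0, 4] : Fin 4 → ℕ)), ((5 : ℤ), (![1, 4, 0, 4] : Fin 4 → ℕ)), ((3 : ℤ), (![1, 5, 0, 4] : Fin 4 → ℕ)), ((9 : ℤ), (![1, 6, 0, 4] : Fin 4 → ℕ)), ((3 : ℤ), (![1, 7, 0, 4] : Fin 4 → ℕ)), ((9 : ℤ), (![1, 8, 0, 4] : Fin 4 → ℕ)), ((5 : ℤ), (![1, 9, 0, 4] : Fin 4 → ℕ)),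
   ((8 : ℤ), (![2, 0, 2, 7] : Fin 4 → ℕ)), ((1 : ℤ), (![2, 0, 5, 4] : Fin 4 → ℕ)), ((1 : ℤ), (![2, 1, 2, 2] : Fin 4 → ℕ)), ((8 : ℤ), (![2, 2, 2, 2] : Fin 4 → ℕ)), ((10 : ℤ), (![2, 2, 4, 4] : Fin 4 → ℕ)), ((7 : ℤ), (![2, 3, 2, 2] : Fin 4 → ℕ)), ((7 : ℤ), (![2, 4, 2, 2] : Fin 4 → ℕ)), ((7 : ℤ), (![2, 5, 2, 2] : Fin 4 → ℕ)), ((2 : ℤ), (![2, 6, 2, 2] : Fin 4 → ℕ)), ((6 : ℤ), (![2, 7, 2, 2] : Fin 4 → ℕ)), ((2 : ℤ), (![2, 8, 2, 2] : Fin 4 → ℕ)), ((6 : ℤ), (![2, 9, 2, 2] : Fin 4 → ℕ)),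
   ((7 : ℤ), (![2, 10, 2, 2] : Fin 4 → ℕ)), ((6 : ℤ), (![2, 11, 0, 0] : Fin 4 → ℕ)), ((10 : ℤ), (![2, 12, 0, 0] : Fin 4 → ℕ)), ((6 : ℤ), (![2, 13, 0, 0] : Fin 4 → ℕ)), ((5 : ℤ), (![2, 14, 0, 0] : Fin 4 → ℕ)), ((4 : ℤ), (![2, 15, 0, 0] : Fin 4 → ℕ)), ((6 : ℤ), (![2, 16, 0, 0] : Fin 4 → ℕ)), ((4 : ℤ), (![2, 17, 0, 0] : Fin 4 → ℕ)), ((5 : ℤ), (![2, 18, 0, 0] : Fin 4 → ℕ)), ((1 : ℤ), (![3, 0, 2, 3] : Fin 4 → ℕ)), ((6 : ℤ), (![3, 0, 2, 6] : Fin 4 → ℕ)), ((7 : ℤ), (![3, 0, 5, 0] : Fin 4 → ℕ)),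
   ((8 : ℤ), (![3, 1, 2, 3] : Fin 4 → ℕ)), ((3 : ℤ), (![3, 1, 2, 6] : Fin 4 → ℕ)), ((8 : ℤ), (![3, 1, 4, 5] : Fin 4 → ℕ)), ((1 : ℤ), (![3, 1, 5, 0] : Fin 4 → ℕ)), ((8 : ℤ), (![3, 1, 7, 2] : Fin 4 → ℕ)), ((7 : ℤ), (![3, 2, 2, 3] : Fin 4 → ℕ)), ((7 : ℤ), (![3, 2, 2, 6] : Fin 4 → ℕ)), ((5 : ℤ), (![3, 2, 5, 0] : Fin 4 → ℕ)), ((7 : ℤ), (![3, 3, 2, 3] : Fin 4 → ℕ)), ((8 : ℤ), (![3, 3, 2, 6] : Fin 4 → ℕ)), ((5 : ℤ), (![3, 3, 5, 0] : Fin 4 → ℕ)), ((7 : ℤ), (![3, 4, 2, 3] : Fin 4 → ℕ)),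
   ((5 : ℤ), (![3, 4, 5, 0] : Fin 4 → ℕ)), ((2 : ℤ), (![3, 5, 2, 3] : Fin 4 → ℕ)), ((3 : ℤ), (![3, 5, 5, 0] : Fin 4 → ℕ)), ((6 : ℤ), (![3, 6, 2, 3] : Fin 4 → ℕ)), ((9 : ℤ), (![3, 6, 5, 0] : Fin 4 → ℕ)), ((2 : ℤ), (![3, 7, 2, 3] : Fin 4 → ℕ)), ((3 : ℤ), (![3, 7, 5, 0] : Fin 4 → ℕ)), ((6 : ℤ), (![3, 8, 2, 3] : Fin 4 → ℕ)), ((9 : ℤ), (![3, 8, 5, 0] : Fin 4 → ℕ)), ((7 : ℤ), (![3, 9, 2, 3] : Fin 4 → ℕ)), ((5 : ℤ), (![3, 9, 5, 0] : Fin 4 → ℕ)), ((5 : ℤ), (![4, 0, 2, 5] : Fin 4 → ℕ)),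
   ((1 : ℤ), (![4, 0, 2, 8] : Fin 4 → ℕ)), ((10 : ℤ), (![4, 0, 4, 6] : Fin 4 → ℕ)), ((8 : ℤ), (![4, 0, 7, 3] : Fin 4 → ℕ)), ((6 : ℤ), (![4, 0, 10, 0] : Fin 4 → ℕ)), ((8 : ℤ), (![4, 1, 2, 2] : Fin 4 → ℕ)), ((3 : ℤ), (![4, 1, 2, 5] : Fin 4 → ℕ)), ((4 : ℤ), (![4, 1, 4, 1] : Fin 4 → ℕ)), ((4 : ℤ), (![4, 1, 4, 4] : Fin 4 → ℕ)), ((2 : ℤ), (![4, 2, 2, 2] : Fin 4 → ℕ)), ((6 : ℤ), (![4, 2, 2, 5] : Fin 4 → ℕ)), ((10 : ℤ), (![4, 2, 4, 1] : Fin 4 → ℕ)), ((2 : ℤ), (![4, 2, 4, 4] : Fin 4 → ℕ)),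
   ((3 : ℤ), (![4, 2, 6, 3] : Fin 4 → ℕ)), ((8 : ℤ), (![4, 3, 2, 2] : Fin 4 → ℕ)), ((3 : ℤ), (![4, 3, 2, 5] : Fin 4 → ℕ)), ((6 : ℤ), (![4, 3, 4, 1] : Fin 4 → ℕ)), ((1 : ℤ), (![4, 3, 4, 4] : Fin 4 → ℕ)), ((4 : ℤ), (![4, 4, 2, 2] : Fin 4 → ℕ)), ((6 : ℤ), (![4, 4, 2, 5] : Fin 4 → ℕ)), ((6 : ℤ), (![4, 4, 4, 1] : Fin 4 → ℕ)), ((9 : ℤ), (![4, 4, 4, 4] : Fin 4 → ℕ)), ((9 : ℤ), (![4, 5, 2, 2] : Fin 4 → ℕ)), ((6 : ℤ), (![4, 5, 2, 5] : Fin 4 → ℕ)), ((6 : ℤ), (![4, 5, 4, 1] : Fin 4 → ℕ)),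
   ((8 : ℤ), (![4, 6, 2, 2] : Fin 4 → ℕ)), ((8 : ℤ), (![4, 6, 2, 5] : Fin 4 → ℕ)), ((8 : ℤ), (![4, 6, 4, 1] : Fin 4 → ℕ)), ((6 : ℤ), (![4, 7, 2, 2] : Fin 4 → ℕ)), ((2 : ℤ), (![4, 7, 4, 1] : Fin 4 → ℕ)), ((1 : ℤ), (![4, 8, 2, 2] : Fin 4 → ℕ)), ((8 : ℤ), (![4, 8, 4, 1] : Fin 4 → ℕ)), ((2 : ℤ), (![4, 9, 4, 1] : Fin 4 → ℕ)), ((1 : ℤ), (![4, 10, 2, 2] : Fin 4 → ℕ)), ((6 : ℤ), (![4, 10, 4, 1] : Fin 4 → ℕ)), ((4 : ℤ), (![4, 12, 2, 2] : Fin 4 → ℕ)), ((7 : ℤ), (![5, 0, 2, 4] : Fin 4 → ℕ)),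
   ((4 : ℤ), (![5, 0, 4, 5] : Fin 4 → ℕ)), ((6 : ℤ), (![5, 0, 7, 2] : Fin 4 → ℕ)), ((1 : ℤ), (![5, 1, 2, 4] : Fin 4 → ℕ)), ((7 : ℤ), (![5, 1, 4, 3] : Fin 4 → ℕ)), ((2 : ℤ), (![5, 1, 4, 5] : Fin 4 → ℕ)), ((8 : ℤ), (![5, 1, 4, 6] : Fin 4 → ℕ)), ((3 : ℤ), (![5, 1, 6, 4] : Fin 4 → ℕ)), ((3 : ℤ), (![5, 1, 7, 2] : Fin 4 → ℕ)), ((10 : ℤ), (![5, 1, 9, 1] : Fin 4 → ℕ)), ((5 : ℤ), (![5, 2, 2, 1] : Fin 4 → ℕ)), ((5 : ℤ), (![5, 2, 2, 4] : Fin 4 → ℕ)), ((2 : ℤ), (![5, 2, 4, 3] : Fin 4 → ℕ)),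
   ((1 : ℤ), (![5, 2, 4, 5] : Fin 4 → ℕ)), ((7 : ℤ), (![5, 2, 7, 2] : Fin 4 → ℕ)), ((1 : ℤ), (![5, 3, 2, 1] : Fin 4 → ℕ)), ((5 : ℤ), (![5, 3, 2, 4] : Fin 4 → ℕ)), ((4 : ℤ), (![5, 3, 4, 3] : Fin 4 → ℕ)), ((9 : ℤ), (![5, 3, 4, 5] : Fin 4 → ℕ)), ((8 : ℤ), (![5, 3, 7, 2] : Fin 4 → ℕ)), ((1 : ℤ), (![5, 4, 2, 1] : Fin 4 → ℕ)), ((5 : ℤ), (![5, 4, 2, 4] : Fin 4 → ℕ)), ((2 : ℤ), (![5, 4, 4, 3] : Fin 4 → ℕ)), ((7 : ℤ), (![5, 5, 2, 1] : Fin 4 → ℕ)), ((3 : ℤ), (![5, 5, 2, 4] : Fin 4 → ℕ)),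
   ((4 : ℤ), (![5, 5, 4, 3] : Fin 4 → ℕ)), ((6 : ℤ), (![5, 6, 2, 1] : Fin 4 → ℕ)), ((9 : ℤ), (![5, 6, 2, 4] : Fin 4 → ℕ)), ((4 : ℤ), (![5, 6, 4, 3] : Fin 4 → ℕ)), ((2 : ℤ), (![5, 7, 2, 1] : Fin 4 → ℕ)), ((3 : ℤ), (![5, 7, 2, 4] : Fin 4 → ℕ)), ((9 : ℤ), (![5, 7, 4, 3] : Fin 4 → ℕ)), ((3 : ℤ), (![5, 8, 2, 1] : Fin 4 → ℕ)), ((9 : ℤ), (![5, 8, 2, 4] : Fin 4 → ℕ)), ((1 : ℤ), (![5, 9, 2, 1] : Fin 4 → ℕ)), ((5 : ℤ), (![5, 9, 2, 4] : Fin 4 → ℕ)), ((4 : ℤ), (![5, 10, 2, 1] : Fin 4 → ℕ)),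
   ((4 : ℤ), (![5, 11, 2, 1] : Fin 4 → ℕ)), ((9 : ℤ), (![5, 12, 2, 1] : Fin 4 → ℕ)), ((6 : ℤ), (![5, 13, 2, 1] : Fin 4 → ℕ)), ((8 : ℤ), (![5, 14, 2, 1] : Fin 4 → ℕ)), ((1 : ℤ), (![6, 0, 4, 4] : Fin 4 → ℕ)), ((5 : ℤ), (![6, 0, 7, 1] : Fin 4 → ℕ)), ((1 : ℤ), (![6, 0, 7, 4] : Fin 4 → ℕ)), ((2 : ℤ), (![6, 1, 4, 4] : Fin 4 → ℕ)), ((5 : ℤ), (![6, 1, 6, 3] : Fin 4 → ℕ)), ((3 : ℤ), (![6, 1, 7, 1] : Fin 4 → ℕ)), ((1 : ℤ), (![6, 2, 4, 4] : Fin 4 → ℕ)), ((8 : ℤ), (![6, 2, 6, 3] : Fin 4 → ℕ)),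
   ((6 : ℤ), (![6, 2, 7, 1] : Fin 4 → ℕ)), ((6 : ℤ), (![6, 2, 8, 2] : Fin 4 → ℕ)), ((4 : ℤ), (![6, 3, 6, 3] : Fin 4 → ℕ)), ((3 : ℤ), (![6, 3, 7, 1] : Fin 4 → ℕ)), ((2 : ℤ), (![6, 4, 4, 4] : Fin 4 → ℕ)), ((3 : ℤ), (![6, 4, 6, 3] : Fin 4 → ℕ)), ((6 : ℤ), (![6, 4, 7, 1] : Fin 4 → ℕ)), ((3 : ℤ), (![6, 5, 4, 4] : Fin 4 → ℕ)), ((6 : ℤ), (![6, 5, 7, 1] : Fin 4 → ℕ)), ((1 : ℤ), (![6, 6, 4, 4] : Fin 4 → ℕ)), ((8 : ℤ), (![6, 6, 7, 1] : Fin 4 → ℕ)), ((3 : ℤ), (![7, 0, 4, 6] : Fin 4 → ℕ)),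
   ((8 : ℤ), (![7, 1, 4, 3] : Fin 4 → ℕ)), ((7 : ℤ), (![7, 1, 4, 6] : Fin 4 → ℕ)), ((6 : ℤ), (![7, 1, 6, 2] : Fin 4 → ℕ)), ((1 : ℤ), (![7, 1, 6, 5] : Fin 4 → ℕ)), ((4 : ℤ), (![7, 2, 4, 3] : Fin 4 → ℕ)), ((9 : ℤ), (![7, 2, 4, 6] : Fin 4 → ℕ)), ((8 : ℤ), (![7, 2, 6, 2] : Fin 4 → ℕ)), ((8 : ℤ), (![7, 3, 4, 3] : Fin 4 → ℕ)), ((4 : ℤ), (![7, 3, 4, 6] : Fin 4 → ℕ)), ((5 : ℤ), (![7, 3, 6, 2] : Fin 4 → ℕ)), ((5 : ℤ), (![7, 4, 4, 3] : Fin 4 → ℕ)), ((8 : ℤ), (![7, 4, 6, 2] : Fin 4 → ℕ)),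
   ((2 : ℤ), (![7, 5, 4, 3] : Fin 4 → ℕ)), ((5 : ℤ), (![7, 5, 6, 2] : Fin 4 → ℕ)), ((5 : ℤ), (![7, 6, 6, 2] : Fin 4 → ℕ)), ((9 : ℤ), (![7, 7, 4, 3] : Fin 4 → ℕ)), ((3 : ℤ), (![7, 7, 6, 2] : Fin 4 → ℕ)), ((6 : ℤ), (![7, 8, 4, 3] : Fin 4 → ℕ)), ((6 : ℤ), (![7, 9, 4, 3] : Fin 4 → ℕ)), ((5 : ℤ), (![8, 0, 4, 5] : Fin 4 → ℕ)), ((6 : ℤ), (![8, 0, 4, 8] : Fin 4 → ℕ)), ((10 : ℤ), (![8, 0, 6, 6] : Fin 4 → ℕ)), ((3 : ℤ), (![8, 0, 9, 3] : Fin 4 → ℕ)), ((3 : ℤ), (![8, 1, 4, 5] : Fin 4 → ℕ)),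
   ((9 : ℤ), (![8, 1, 6, 4] : Fin 4 → ℕ)), ((5 : ℤ), (![8, 2, 4, 2] : Fin 4 → ℕ)), ((6 : ℤ), (![8, 2, 4, 5] : Fin 4 → ℕ)), ((10 : ℤ), (![8, 2, 6, 4] : Fin 4 → ℕ)), ((9 : ℤ), (![8, 3, 4, 2] : Fin 4 → ℕ)), ((3 : ℤ), (![8, 3, 4, 5] : Fin 4 → ℕ)), ((5 : ℤ), (![8, 3, 6, 4] : Fin 4 → ℕ)), ((8 : ℤ), (![8, 4, 4, 2] : Fin 4 → ℕ)), ((6 : ℤ), (![8, 4, 4, 5] : Fin 4 → ℕ)), ((1 : ℤ), (![8, 4, 6, 4] : Fin 4 → ℕ)), ((4 : ℤ), (![8, 5, 4, 2] : Fin 4 → ℕ)), ((6 : ℤ), (![8, 5, 4, 5] : Fin 4 → ℕ)),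
   ((5 : ℤ), (![8, 6, 4, 2] : Fin 4 → ℕ)), ((8 : ℤ), (![8, 6, 4, 5] : Fin 4 → ℕ)), ((9 : ℤ), (![8, 7, 4, 2] : Fin 4 → ℕ)), ((5 : ℤ), (![8, 8, 4, 2] : Fin 4 → ℕ)), ((7 : ℤ), (![8, 9, 4, 2] : Fin 4 → ℕ)), ((3 : ℤ), (![8, 10, 4, 2] : Fin 4 → ℕ)), ((6 : ℤ), (![8, 11, 4, 2] : Fin 4 → ℕ)), ((3 : ℤ), (![9, 0, 6, 5] : Fin 4 → ℕ)), ((8 : ℤ), (![9, 0, 9, 2] : Fin 4 → ℕ)), ((7 : ℤ), (![9, 1, 6, 5] : Fin 4 → ℕ)), ((8 : ℤ), (![9, 1, 8, 4] : Fin 4 → ℕ)), ((4 : ℤ), (![9, 1, 9, 2] : Fin 4 → ℕ)),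
   ((9 : ℤ), (![9, 2, 6, 5] : Fin 4 → ℕ)), ((2 : ℤ), (![9, 2, 9, 2] : Fin 4 → ℕ)), ((4 : ℤ), (![9, 3, 6, 5] : Fin 4 → ℕ)), ((7 : ℤ), (![9, 3, 9, 2] : Fin 4 → ℕ)), ((8 : ℤ), (![10, 0, 6, 7] : Fin 4 → ℕ)), ((2 : ℤ), (![10, 1, 6, 4] : Fin 4 → ℕ)), ((3 : ℤ), (![10, 1, 8, 3] : Fin 4 → ℕ)), ((6 : ℤ), (![10, 2, 6, 4] : Fin 4 → ℕ)), ((7 : ℤ), (![10, 2, 8, 3] : Fin 4 → ℕ)), ((7 : ℤ), (![10, 3, 6, 4] : Fin 4 → ℕ)), ((9 : ℤ), (![10, 3, 8, 3] : Fin 4 → ℕ)), ((9 : ℤ), (![10, 4, 6, 4] : Fin 4 → ℕ)),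
   ((4 : ℤ), (![10, 4, 8, 3] : Fin 4 → ℕ)), ((1 : ℤ), (![10, 5, 6, 4] : Fin 4 → ℕ)), ((7 : ℤ), (![10, 6, 6, 4] : Fin 4 → ℕ)), ((8 : ℤ), (![11, 0, 6, 6] : Fin 4 → ℕ)), ((4 : ℤ), (![11, 1, 6, 6] : Fin 4 → ℕ)), ((7 : ℤ), (![11, 1, 8, 5] : Fin 4 → ℕ)), ((4 : ℤ), (![11, 2, 6, 3] : Fin 4 → ℕ)), ((2 : ℤ), (![11, 2, 6, 6] : Fin 4 → ℕ)), ((2 : ℤ), (![11, 3, 6, 3] : Fin 4 → ℕ)), ((7 : ℤ), (![11, 3, 6, 6] : Fin 4 → ℕ)), ((6 : ℤ), (![11, 4, 6, 3] : Fin 4 → ℕ)), ((8 : ℤ), (![11, 5, 6, 3] : Fin 4 → ℕ)),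
   ((6 : ℤ), (![11, 6, 6, 3] : Fin 4 → ℕ)), ((9 : ℤ), (![11, 7, 6, 3] : Fin 4 → ℕ)), ((9 : ℤ), (![11, 8, 6, 3] : Fin 4 → ℕ)), ((4 : ℤ), (![11, 9, 6, 3] : Fin 4 → ℕ)), ((5 : ℤ), (![12, 0, 11, 3] : Fin 4 → ℕ)), ((6 : ℤ), (![13, 1, 10, 4] : Fin 4 → ℕ)), ((5 : ℤ), (![14, 0, 8, 7] : Fin 4 → ℕ))]

variable (K : Type) [Field K]

/-- Stage `S` (bed c, stage 2, chart origin `x₂`): `Exc = {t′}`, `d_{t′} = 1`. [data] -/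
def S : Stage K := ⟨evalL K b2L, evalL K b1L, evalL K b0L, {0}, fun n => if n = 0 then 1 else 0⟩

/-- Stage `S′` (the `t′`-chart origin of the blow-up of `Π₂`): `Exc′ = {t′}`, `d′ ≡ 0`. [data] -/
def S' : Stage K := ⟨evalL K b2L', evalL K b1L', evalL K b0L', {0}, fun _ => 0⟩

/-- The centre `Π₂ = V(x″, t′, y₄″)`: normal letters `{0, 3}`. [data] -/
def Nor : Finset Letter := {0, 3}

/-- The chart direction `L = t′`. [data] -/
def L : Letter := 0

/-- The exceptional part `α = 4·ε_{t′}` of `Disc_x(S)`. [data] -/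
def α : Expo := Finsupp.single 0 4

/-- The residual `N₂` as a polynomial. [data] -/
def N : YPoly K := evalL K N2L

/-! ## §3 The hypotheses of the door at the instance -/

section Instance

variable {K}

/-- `norDeg {0,3} e = e 0 + e 3`. [plumbing] -/
theorem norDeg_nor (e : Expo) : norDeg Nor e = e 0 + e 3 := by
  simp [norDeg, Nor]

/-- `tdeg e = e 0 + e 1 + e 2 + e 3`. [plumbing] -/
theorem tdeg_eq (e : Expo) : tdeg e = e 0 + e 1 + e 2 + e 3 := by
  simp [tdeg, Fin.sum_univ_four]

variable (K)

/-- `Nor` is non-empty, proper, and contains `L`. [plumbing] -/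
theorem nor_facts : (Nor).Nonempty ∧ Nor ≠ Finset.univ ∧ L ∈ Nor := ⟨⟨0, by simp [Nor]⟩, by decide, by simp [Nor, L]⟩

/-- PERMISSIBLE: `X₂` is normally flat of multiplicity 3 along `Π₂` (`bᵢ ∈ I_Z^{3−i}`, checked on the three supports). [OURS · certificate] -/
theorem permissible : Permissible (S K) Nor := by
  refine ⟨fun e he => ?_, fun e he => ?_, fun e he => ?_⟩
  · have h := forall_support_of_list (K := K) b2L (fun v => 1 ≤ v 0 + v 3) (by decide) e he
    simpa [norDeg_nor] using h
  · have h := forall_support_of_list (K := K) b1L (fun v => 2 ≤ v 0 + v 3) (by decide) e he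
    simpa [norDeg_nor] using h
  · have h := forall_support_of_list (K := K) b0L (fun v => 3 ≤ v 0 + v 3) (by decide) e he
    simpa [norDeg_nor] using h

/-- COORDINATE CANONICITY: neither `V(x″, y₄″)` (witness `t′ ∈ supp b₂`) nor `V(x″, t′)` (witness `y₄″ ∈ supp b₂`) is a triple 3-fold. [OURS · certificate] -/
theorem coordCanonical [CharP K 11] : CoordCanonical (S K) Nor := by
  intro n₀ hn₀ _ hperm
  simp only [Nor, Finset.mem_insert, Finset.mem_singleton] at hn₀
  rcases hn₀ with rfl | rfl
  · rw [show (Nor).erase 0 = ({3} : Finset Letter) from by decide] at hperm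
    have hmem : Finsupp.equivFunOnFinite.symm (![1, 0, 0, 0] : Fin 4 → ℕ) ∈ (S K).b₂.support :=
      mem_support_evalL_of_not_dvd 11 b2L _ (by decide)
    have h := hperm.1 _ hmem
    simp [norDeg] at h
  · rw [show (Nor).erase 3 = ({0} : Finset Letter) from by decide] at hperm
    have hmem : Finsupp.equivFunOnFinite.symm (![0, 0, 0, 1] : Fin 4 → ℕ) ∈ (S K).b₂.support :=
      mem_support_evalL_of_not_dvd 11 b2L _ (by decide)
    have h := hperm.1 _ hmem
    simp [norDeg] at h

/-- DROP POINT at `S′`: `b₂′(0) = 1 ≠ 0`, `b₁′(0) = 0`, `ord b₀′ ≥ 2`. [OURS · certificate] -/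
theorem isDropPoint [CharP K 11] : IsDropPoint (S' K) := by
  refine ⟨?_, ?_, fun e he => ?_⟩
  · rw [show (S' K).b₂ = evalL K b2L' from rfl, coeff_zero_evalL,
      show (((b2L'.filter fun t : ℤ × (Fin 4 → ℕ) => t.2 = 0).map fun t : ℤ × (Fin 4 → ℕ) => t.1).sum : ℤ) = 1 from by decide, Int.cast_one]
    exact one_ne_zero
  · rw [show (S' K).b₁ = evalL K b1L' from rfl, coeff_zero_evalL,
      show (((b1L'.filter fun t : ℤ × (Fin 4 → ℕ) => t.2 = 0).map fun t : ℤ × (Fin 4 → ℕ) => t.1).sum : ℤ) = 0 from by decide, Int.cast_zero]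
  · have h := forall_support_of_list (K := K) b0L' (fun v => 2 ≤ v 0 + v 1 + v 2 + v 3) (by decide) e he
    simpa [tdeg_eq] using h

/-- BUDGET at `S`: the monomial `x″·t′·y₄″` of `b₁` dominates every weight: `wx + w₀ + w₃ ≤ wx + Σw + d₀·w₀`. [OURS · certificate] -/
theorem budgeted_S [CharP K 11] : Budgeted (S K) := by
  intro wx w
  right
  refine ⟨1, Finsupp.equivFunOnFinite.symm (![1, 0, 0, 1] : Fin 4 → ℕ), ?_, ?_⟩
  · simp only [Matrix.cons_val_one]
    exact mem_support_evalL_of_not_dvd 11 b1L _ (by decide)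
  · simp [S, Fin.sum_univ_four]
    omega

/-- BUDGET at `S′`: the monomial `x‴·y₄‴` of `b₁′` dominates every weight. [OURS · certificate] -/
theorem budgeted_S' [CharP K 11] : Budgeted (S' K) := by
  intro wx w
  right
  refine ⟨1, Finsupp.equivFunOnFinite.symm (![0, 0, 0, 1] : Fin 4 → ℕ), ?_, ?_⟩
  · simp only [Matrix.cons_val_one]
    exact mem_support_evalL_of_not_dvd 11 b1L' _ (by decide)
  · simp [S', Fin.sum_univ_four]
    omega

/-- ★★ THE CONE-INITIAL CUT FAILS: `ν = 2` (witness `t′²ỹ₂¹⁷`) and every monomial of `N₂` of normal degree `≤ 2` has total degree `> 8 + e_{t′}`. [OURS · certificate] -/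
theorem not_axisOrdLE [CharP K 11] : ¬ AxisOrdLE Nor L (N K) 8 := by
  rintro ⟨e, he, hmin, hle⟩
  have hw : Finsupp.equivFunOnFinite.symm (![2, 17, 0, 0] : Fin 4 → ℕ) ∈ (N K).support :=
    mem_support_evalL_of_not_dvd 11 N2L _ (by decide)
  have h1 := hmin _ hw
  rw [norDeg_nor, norDeg_nor] at h1
  simp only [Finsupp.coe_equivFunOnFinite_symm, Matrix.cons_val_zero] at h1
  have h1' : e 0 + e 3 ≤ 2 := by simpa using h1
  rw [tdeg_eq, L] at hle
  have h := forall_support_of_list (K := K) N2L (fun v => v 0 + v 3 ≤ 2 → 8 + v 0 < v 0 + v 1 + v 2 + v 3) (by decide +kernel) e he h1'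
  omega

/-- The residual-decomposition side conditions: `α` lives on `Exc = {t′}`, and `N₂` is prime to `t′` (witness `y₄″⁸`). [OURS · certificate] -/
theorem isResidual_sides [CharP K 11] : (∀ n, n ∉ (S K).Exc → α n = 0) ∧ ∀ n ∈ (S K).Exc, ∃ e ∈ (N K).support, e n = 0 := by
  refine ⟨fun n hn => ?_, fun n hn => ?_⟩
  · simp only [S, Finset.mem_singleton] at hn
    simp [α, Ne.symm hn]
  · simp only [S, Finset.mem_singleton] at hn
    subst hn
    exact ⟨_, mem_support_evalL_of_not_dvd 11 N2L (![0, 0, 0, 8] : Fin 4 → ℕ) (by decide), by simp⟩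

end Instance

/-! ## §4 The two polynomial identities through the keyed kit arithmetic (one `decide +kernel` each): the chart transform and the discriminant -/

section Identities

variable {K}

/-- The three chart certificates (data checks). [computational certificate] -/
theorem chartNF_dvd : (∀ t ∈ chartNF Nor L b2L b2L' 1, (11 : ℤ) ∣ t.1) ∧ (∀ t ∈ chartNF Nor L b1L b1L' 2, (11 : ℤ) ∣ t.1) ∧ (∀ t ∈ chartNF Nor L b0L b0L' 3, (11 : ℤ) ∣ t.1) := by
  have h : ((chartNF Nor L b2L b2L' 1).all fun t => decide ((11 : ℤ) ∣ t.1)) = true ∧ ((chartNF Nor L b1L b1L' 2).all fun t => decide ((11 : ℤ) ∣ t.1)) = true ∧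
      ((chartNF Nor L b0L b0L' 3).all fun t => decide ((11 : ℤ) ∣ t.1)) = true := by
    decide +kernel
  simp only [List.all_eq_true, decide_eq_true_eq] at h
  exact h

variable (K) in
/-- IS-CHART: `S′` is the `t′`-chart origin stage of the blow-up of `S` along `Π₂` — `σ(bᵢ) = t′^{3−i}bᵢ′` (kernel-checked mod 11), `Exc′ = Exc ∪ {t′} = {t′}`,
`d′_{t′} = (|Nor| + 1 − 4) + d_{t′} = 0`. [OURS · certificate] -/
theorem isChart [CharP K 11] : IsChart (S K) Nor L (S' K) := by
  refine ⟨?_, ?_, ?_, ?_, fun n hn => ?_, ?_⟩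
  · have h := chart_identity_of_nf (K := K) 11 Nor L b2L b2L' 1 chartNF_dvd.1
    rw [pow_one] at h
    exact h
  · exact chart_identity_of_nf (K := K) 11 Nor L b1L b1L' 2 chartNF_dvd.2.1
  · exact chart_identity_of_nf (K := K) 11 Nor L b0L b0L' 3 chartNF_dvd.2.2
  · simp [S, S', L]
  · have hn' : n ≠ 0 := by simpa [L] using hn
    simp [S, S', hn']
  · simp [S, S', Nor, L]

/-- The keyed computation of `Disc_x(S)`. [certificate data] -/
def discK : List (ℤ × ℕ × (Fin 4 → ℕ)) := discExpr (nk b2L) (nk b1L) (nk b0L)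

variable (K) in
/-- The value of `discK` is `Disc_x(S)`. [plumbing] -/
theorem evalK_discK : evalK K discK = (S K).D := by
  rw [discK, evalK_discExpr, evalK_nk, evalK_nk, evalK_nk]
  rfl

/-- The keyed normal form of `Disc_x(S) − t′⁴·N₂`. [certificate data] -/
def residualNF : List (ℤ × ℕ × (Fin 4 → ℕ)) :=
  addNFK discK (shiftK ((-1 : ℤ), key (![4, 0, 0, 0] : Fin 4 → ℕ), (![4, 0, 0, 0] : Fin 4 → ℕ)) (nk N2L))

/-- The discriminant certificate: all coefficients of `residualNF` vanish mod 11 (the kernel multiplies the `bᵢ` out). [computational certificate] -/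
theorem residualNF_dvd : ∀ t ∈ residualNF, (11 : ℤ) ∣ t.1 := by
  have h : (residualNF.all fun t => decide ((11 : ℤ) ∣ t.1)) = true := by decide +kernel
  simpa only [List.all_eq_true, decide_eq_true_eq] using h

variable (K) in
/-- IS-RESIDUAL: `Disc_x(S) = t′⁴ · N₂`, `α = 4ε₀` lives on `Exc = {t′}`, `N₂` is prime to `t′`. [OURS · certificate] -/
theorem isResidual [CharP K 11] : IsResidual (S K).Exc (S K).D α (N K) := by
  refine ⟨?_, (isResidual_sides K).1, (isResidual_sides K).2⟩
  have hz := evalK_eq_zero_of_dvd K 11 residualNF residualNF_dvd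
  rw [residualNF, evalK_addNFK, evalK_discK, evalK_shiftK, evalK_nk, Int.cast_neg, Int.cast_one, map_neg, neg_mul] at hz
  have hα : (Finsupp.equivFunOnFinite.symm (![4, 0, 0, 0] : Fin 4 → ℕ) : Fin 4 →₀ ℕ) = α := by
    ext i; fin_cases i <;> simp [α]
  rw [hα] at hz
  rw [N]
  exact (sub_eq_zero.mp (by rw [sub_eq_add_neg]; exact hz))

end Identities

/-! ## §5 The counterexample and the refutation of the typed door `LastCentreConeBound CoordCanonical` (= `DoorCoordProxy` of `Lines/T_canon_door.lean` §3) -/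

/-- ★★★ **THE COUNTEREXAMPLE**: over every field of characteristic 11 the stage-2 data of bed c at the canonical surface centre `Π₂` satisfy EVERY hypothesis of the typed door
(`Nor` non-empty, proper, `L ∈ Nor`, permissible, coordinate-canonical, budgeted, chart, drop point, budgeted, residual) while the cone-initial conclusion `AxisOrdLE Nor L N 8` FAILS.
[OURS · kernel negative; res-L1-w45a-plan-1 R25.41 (B)] -/
theorem counterexample (K : Type) [Field K] [CharP K 11] :
    ∃ (S S' : Stage K) (Nor : Finset Letter) (L : Letter) (α : Expo) (N : YPoly K),
      Nor.Nonempty ∧ Nor ≠ Finset.univ ∧ L ∈ Nor ∧ Permissible S Nor ∧ CoordCanonical S Nor ∧ Budgeted S ∧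
        IsChart S Nor L S' ∧ IsDropPoint S' ∧ Budgeted S' ∧ IsResidual S.Exc S.D α N ∧ ¬ AxisOrdLE Nor L N 8 :=
  ⟨S K, S' K, Nor, L, α, N K, nor_facts.1, nor_facts.2.1, nor_facts.2.2, permissible K, coordCanonical K, budgeted_S K,
    isChart K, isDropPoint K, budgeted_S' K, isResidual K, not_axisOrdLE K⟩

/-- ★★★ **THE TYPED DOOR `LastCentreConeBound CoordCanonical` (`DoorCoordProxy`) IS FALSE** — its ∀-statement, restated VERBATIM from `Lines/T_canon_door.lean` §3 with
`Canon := CoordCanonical`, is refuted by the instance over `ZMod 11`. (The cap MC-8ᶜ is NOT refuted: the exact one-step law gives `ρ′ = 6` here — evidence level.)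
[OURS · kernel negative; res-L1-w45a-plan-1 R25.41 (iii)] -/
theorem not_lastCentreConeBound_coordCanonical :
    ¬ (∀ (k : Type) [Field k] (S S' : Stage k) (Nor : Finset Letter) (L : Letter) (α : Expo) (N : YPoly k),
        Nor.Nonempty → L ∈ Nor → Permissible S Nor → CoordCanonical S Nor → Budgeted S →
          IsChart S Nor L S' → IsDropPoint S' → Budgeted S' → IsResidual S.Exc S.D α N →
            AxisOrdLE Nor L N 8) := by
  intro h
  haveI : Fact (Nat.Prime 11) := ⟨by norm_num⟩
  exact not_axisOrdLE (ZMod 11) (h (ZMod 11) (S _) (S' _) Nor L α (N _) nor_facts.1 nor_facts.2.2 (permissible _)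
    (coordCanonical _) (budgeted_S _) (isChart _) (isDropPoint _) (budgeted_S' _) (isResidual _))

end Summit.ResolutionOfSingularities.ResolutionOfSingularities.Theorems.FInjectiveMacaulayfication.LastCentreBedC

end
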